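import Summits.BirchSwinnertonDyer.Rank1Residual.Additive.X3GordBranchPAdicGrossZagier
import Summits.BirchSwinnertonDyer.Rank1Residual.Additive.GordBranchPAdicGrossZagierOddThree
import Literature.NumberTheory.EllipticCurves.Pal2012.QuadraticTwistPeriodProofs
import HarnessLib

/-!
# T-O7c (v), X3♯(G-ord) sequel: the forward LOWER class forms at `p ≥ 5` and the loop CLOSED on
# X3♯(G-ord) ∩ `I₀*` (REDUCIBLE `E[p]`, NO image hypothesis) in analytic rank one — `BSD(E,p) ⟺` the
# typed branch `p`-adic Gross–Zagier for every (B)-datum, GIVEN the branch IMC (our typed LOWER ∧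
# Wuthrich 2014 Thm. 16, published) and Delbourgo 2002 (A)+(B) with the rider; even branch, odd branch
# `p ≥ 7`, odd branch `p = 3` (cell `b2b-bsdres`, team n1011, seat p01 GEN 2, OWNERS row T-O7c; X3 twin
# of `BranchPAdicGrossZagierIff.lean`; the `p = 3` forward form is n1011-p12's
# `GordBranchPAdicGrossZagierOddThree.lean`)

HONEST FRAMING (cell `b2b-bsdres`, run/shared/lean/b2b/bsd-rank1-residual/, verbatim in every
file): prove what is provable now; shrink each hard class to its core with data; no claim beyond
stated classes. Research routes; census output = EVIDENCE / conjecture items, never a Literature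
fact; RESIDUAL-MAP marks change only by signed lines. §I O7 stays OPEN; X3♯(G-ord) stays
CONSTRUCTION-SHAPED; nothing is booked; no label changes. COVERAGE (stated first, referee 1
proviso): X3♯(G-ord) ∩ `I₀*` ∧ `r_an = 1`, non-CM, non-anomalous: `p ≡ 1 (mod 4)` (A175), `p ≡ 3
(mod 4)` with `p ≥ 5` (A175), `p = 3` (p16's `Delbourgo2002.mainTheorem_three`); NO surjectivity /
tower hypothesis anywhere (reducible image: Wuthrich Thm. 16). NO definition, NO Literature fact
minted, NO `_holds` of a new fact; theorems only. Pal 2012 Thm. 3.2 enters the even-branch lower half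
as the tree THEOREM `Pal2012.thm32_sqrt_mul_realPeriodRat_twist_eq_of_prime_one_mod_four_holds`.
CAVEAT (p07/p10, inherited): on X3 the Néron-normalised typed LOWER `ChiBranchLowerDivisibility[Odd]At`
is OUR conjecture and may need a `p`-power renormalisation on some reducible rows — it is a
HYPOTHESIS of every theorem below, nothing is asserted.

## What

* §1 forward LOWER class forms on X3♯(G-ord), `p ≥ 5`: even / odd (`ClassX3Gord.missingLowerBoundAt_
  rankOne_of_chiBranchLower[Odd]_of_branchPAdicGrossZagier[Odd]`) — gen 1's factorisations into
  `ClassX3Gord.missingLowerBoundAt_rankLeOne_of_cycLowerBound` (the `p = 3` odd form is n1011-p12's).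
* §2 `BSDp` from [typed LOWER ∧ Wuthrich's half ∧ Delbourgo ∧ (rider ∧ typed p-adic GZ ∀ (B)-data)] and
  the iffs `BSDp W p ↔ ∀ Dh, LeadingTermClauses W p Dh → BranchPAdicGrossZagier[Odd]At W p Dh` under the
  rider ∀ — even, odd `p ≥ 7`, odd `p = 3`.

References: [Wuthrich2014] Thm. 16; [Delbourgo2002] Thm. (A), (B), Example p. 40; [Pal2012] Thm. 3.2;
[MazurTateTeitelbaum1986Invent] §I.13–I.14; [Miller2011LMS] Def. 1.1.
-/

noncomputable section

open scoped Classical MatrixGroups ModularForm NumberField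

open CongruenceSubgroup WeierstrassCurve NumberField Literature.NumberTheory.EllipticCurves
  Literature.NumberTheory.EllipticCurves.ModularForms
  Literature.NumberTheory.EllipticCurves.Rank1Residual
  Literature.NumberTheory.EllipticCurves.Rank1Residual.Typed
  Literature.NumberTheory.EllipticCurves.Delbourgo2002
  Literature.NumberTheory.GaloisRepresentations
  IsDedekindDomain

namespace Summit.BirchSwinnertonDyer.Rank1Residual.Additive

variable {W : WeierstrassCurve ℚ} [W.IsElliptic] [W.IsGloballyMinimal] {p : ℕ} [hp : Fact p.Prime]

/-! ### §1 X3♯(G-ord), `p ≥ 5`: the forward LOWER class forms -/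

/-- **X3♯(G-ord) ∩ `I₀*`, `p ≡ 1 (mod 4)`, non-CM, non-anomalous, `r_an = 1`: the LOWER half from the
two typed inputs of the even-branch route** (`ChiBranchLowerDivisibilityAt W p` and, for every
(B)-datum, the rider + `BranchPAdicGrossZagierAt W p Dh`); Delbourgo 2002 (A)+(B) (A175), modularity,
GZK published; Pal 2012 Thm. 3.2 a tree theorem; the twist datum DISCHARGED
(`ClassX3Gord.exists_goodOrd_pStar_twist_model`, `hmodD`). X3 twin of gen 1's `ClassX4Gord.…`.
[cite: Delbourgo2002, Theorem (A), (B) (p. 40)] [cite: Pal2012, Thm. 3.2] [cite: Miller2011LMS, Def. 1.1] -/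
theorem ClassX3Gord.missingLowerBoundAt_rankOne_of_chiBranchLower_of_branchPAdicGrossZagier
    (hDel : Delbourgo2002.mainTheorem) (hmod : hasEntireLFunction_rat)
    (hmodD : nonempty_modularParametrizationData) (hGZK : rank_eq_analyticRank_of_analyticRank_le_one)
    (hX : ClassX3Gord W p) (he : semistabilityIndex W p = 2) (hp4 : p % 4 = 1) (hcm : ¬ W.HasCM)
    (hna : ReductionNonAnomalous W p) (hr : W.analyticRank = 1) (hdiv : ChiBranchLowerDivisibilityAt W p)
    (hGZ : ∀ Dh : PAdicHeightData W p, LeadingTermClauses W p Dh →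
      SchneiderConjecture Dh ∧ BranchPAdicGrossZagierAt W p Dh) :
    MissingLowerBoundAt W p := by
  have hp2 : p ≠ 2 := by omega
  have hp5 : 5 ≤ p := by have := hp.out.two_le; omega
  obtain ⟨V, iV, iVm, C, hV, hC⟩ := ClassX3Gord.exists_goodOrd_pStar_twist_model W p hp2 hX he
  haveI : NeZero (V.conductorNorm ℤ) := ⟨(V.conductorNorm_pos_holds).ne'⟩
  obtain ⟨Dm⟩ := hmodD V
  obtain ⟨ϖ, -, hϖ, -⟩ := Dm.exists_rat_mul_realPeriodRat_eq_plusPeriod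
  have hps : ((-1 : ℚ) ^ (p / 2) * (p : ℚ)) = (p : ℚ) := by
    have heven : Even (p / 2) := ⟨p / 4, by omega⟩
    rw [heven.neg_one_pow, one_mul]
  have hVW : ∃ C : VariableChange ℚ, C • V.quadraticTwist (p : ℚ) = W := ⟨C, by rw [← hps]; exact hC⟩
  refine hX.missingLowerBoundAt_rankLeOne_of_cycLowerBound hDel hGZK hp5 hcm hr.le hna fun Dh hB ↦ ?_
  obtain ⟨hS, hGZDh⟩ := hGZ Dh hB
  exact ⟨hS, cycLowerBoundAt_of_chiBranchLower_of_branchPAdicGrossZagier W p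
    Pal2012.thm32_sqrt_mul_realPeriodRat_twist_eq_of_prime_one_mod_four_holds hmod hGZK hX.1.2 hr hp4 V
    hVW hV Dm.isNewformOf ϖ hϖ hdiv hGZDh⟩

/-- **X3♯(G-ord) ∩ `I₀*`, `p ≡ 3 (mod 4)`, `p ≥ 5` (i.e. `p ≥ 7`), non-CM, non-anomalous, `r_an = 1`:
the LOWER half from the two typed inputs of the odd-branch route** (`ChiBranchLowerDivisibilityOddAt`
and, for every (B)-datum, the rider + `BranchPAdicGrossZagierOddAt`). X3 twin of gen 1's `ClassX4Gord.…`;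
the `p = 3` form is n1011-p12's. [cite: Delbourgo2002, Theorem (A), (B) (p. 40)] [cite: Miller2011LMS, Def. 1.1] -/
theorem ClassX3Gord.missingLowerBoundAt_rankOne_of_chiBranchLowerOdd_of_branchPAdicGrossZagierOdd
    (hDel : Delbourgo2002.mainTheorem) (hmod : hasEntireLFunction_rat)
    (hmodD : nonempty_modularParametrizationData) (hGZK : rank_eq_analyticRank_of_analyticRank_le_one)
    (hX : ClassX3Gord W p) (he : semistabilityIndex W p = 2) (hp4 : p % 4 = 3) (hp5 : 5 ≤ p)
    (hcm : ¬ W.HasCM) (hna : ReductionNonAnomalous W p) (hr : W.analyticRank = 1)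
    (hdiv : ChiBranchLowerDivisibilityOddAt W p)
    (hGZ : ∀ Dh : PAdicHeightData W p, LeadingTermClauses W p Dh →
      SchneiderConjecture Dh ∧ BranchPAdicGrossZagierOddAt W p Dh) :
    MissingLowerBoundAt W p := by
  have hp2 : p ≠ 2 := by omega
  obtain ⟨V, iV, iVm, C, hV, hC⟩ := ClassX3Gord.exists_goodOrd_pStar_twist_model W p hp2 hX he
  haveI : NeZero (V.conductorNorm ℤ) := ⟨(V.conductorNorm_pos_holds).ne'⟩
  obtain ⟨Dm⟩ := hmodD V
  obtain ⟨ϖ, -, hϖ⟩ := exists_rat_mul_imaginaryPeriodRat_eq_minusPeriod Dm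
  have hps : ((-1 : ℚ) ^ (p / 2) * (p : ℚ)) = -(p : ℚ) := by
    rw [pStar_eq_of_mod_four p (Or.inr hp4), if_neg (by omega)]
  have hVW : ∃ C : VariableChange ℚ, C • V.quadraticTwist (-(p : ℚ)) = W :=
    ⟨C, by rw [← hps]; exact hC⟩
  refine hX.missingLowerBoundAt_rankLeOne_of_cycLowerBound hDel hGZK hp5 hcm hr.le hna fun Dh hB ↦ ?_
  obtain ⟨hS, hGZDh⟩ := hGZ Dh hB
  exact ⟨hS, cycLowerBoundAt_of_chiBranchLowerOdd_of_branchPAdicGrossZagierOdd W p hmod hGZK hX.1.2 hr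
    hp4 V hVW hV Dm.isNewformOf ϖ hϖ hdiv hGZDh⟩

/-! ### §2 X3♯(G-ord): `BSDp` from both halves, and the iffs -/

/-- **X3♯(G-ord) ∩ `I₀*`, `p ≡ 1 (mod 4)`, non-CM, non-anomalous, `r_an = 1`: `BSD(E,p)` from the branch
IMC (typed LOWER `hdiv` + Wuthrich's half, published) ∧ Delbourgo 2002 (A)+(B) ∧ [rider ∧ typed
even-branch `p`-adic GZ for every (B)-datum]** — NO image hypothesis. Lower half §1, upper half
`ClassX3Gord.missingUpperBoundAt_rankOne_of_wuthrichHalf_of_schneider_of_branchPAdicGrossZagier`.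
[cite: Wuthrich2014, Thm. 16 (p. 397)] [cite: Delbourgo2002, Theorem (A), (B) (p. 40)] [cite: Miller2011LMS, Def. 1.1] -/
theorem ClassX3Gord.bsdp_rankOne_of_chiBranchLower_of_wuthrichHalf_of_branchPAdicGrossZagier
    (hDel : Delbourgo2002.mainTheorem) (hWu : Wuthrich2014.thm16_halfEigenCharIdeal_dvd_cyclotomicPrime)
    (hmod : hasEntireLFunction_rat) (hmodD : nonempty_modularParametrizationData)
    (hGZK : rank_eq_analyticRank_of_analyticRank_le_one) (hX : ClassX3Gord W p)
    (he : semistabilityIndex W p = 2) (hp4 : p % 4 = 1) (hcm : ¬ W.HasCM)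
    (hna : ReductionNonAnomalous W p) (hr : W.analyticRank = 1) (hdiv : ChiBranchLowerDivisibilityAt W p)
    (hGZ : ∀ Dh : PAdicHeightData W p, LeadingTermClauses W p Dh →
      SchneiderConjecture Dh ∧ BranchPAdicGrossZagierAt W p Dh) : BSDp W p := by
  have hp5 : 5 ≤ p := by have := hp.out.two_le; omega
  have hl : MissingLowerBoundAt W p :=
    hX.missingLowerBoundAt_rankOne_of_chiBranchLower_of_branchPAdicGrossZagier hDel hmod hmodD hGZK he hp4
      hcm hna hr hdiv hGZ
  obtain ⟨Dh, hB⟩ := hDel.exists_leadingTermClauses hp5 hcm hX.1.2 hX.2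
  obtain ⟨hS, hGZDh⟩ := hGZ Dh hB
  have hu : MissingUpperBoundAt W p :=
    hX.missingUpperBoundAt_rankOne_of_wuthrichHalf_of_schneider_of_branchPAdicGrossZagier hWu hGZK hmod hmodD he hp4 hr
      hB hS hGZDh
  exact bsdp_of_missingPPartAt W p hGZK (by rw [hr]) (missingPPartAt_of_lower_of_upper W p hl hu)

/-- **THE LOOP CLOSED on X3♯(G-ord), even branch (iff):** GIVEN the branch IMC (typed LOWER + Wuthrich's
half), Delbourgo 2002 (A)+(B), modularity, GZK and the rider for every (B)-datum (`hSall`):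
`BSD(E,p) ⟺` the typed even-branch `p`-adic Gross–Zagier for every (B)-datum.
[cite: Wuthrich2014, Thm. 16 (p. 397)] [cite: Delbourgo2002, Theorem (A), (B) (p. 40)] [cite: Miller2011LMS, Def. 1.1] -/
theorem ClassX3Gord.bsdp_iff_forall_branchPAdicGrossZagierAt_of_chiBranchLower_of_wuthrichHalf
    (hDel : Delbourgo2002.mainTheorem) (hWu : Wuthrich2014.thm16_halfEigenCharIdeal_dvd_cyclotomicPrime)
    (hmod : hasEntireLFunction_rat) (hmodD : nonempty_modularParametrizationData)
    (hGZK : rank_eq_analyticRank_of_analyticRank_le_one) (hX : ClassX3Gord W p)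
    (he : semistabilityIndex W p = 2) (hp4 : p % 4 = 1) (hcm : ¬ W.HasCM)
    (hna : ReductionNonAnomalous W p) (hr : W.analyticRank = 1) (hdiv : ChiBranchLowerDivisibilityAt W p)
    (hSall : ∀ Dh : PAdicHeightData W p, LeadingTermClauses W p Dh → SchneiderConjecture Dh) :
    BSDp W p ↔ ∀ Dh : PAdicHeightData W p, LeadingTermClauses W p Dh → BranchPAdicGrossZagierAt W p Dh := by
  refine ⟨fun hbsd Dh hB ↦ ?_, fun hGZ ↦ ?_⟩
  · exact hX.branchPAdicGrossZagierAt_of_bsdp_of_chiBranchLower_of_wuthrichHalf hWu hmod hr hna hbsd hdiv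
      hB (hSall Dh hB)
  · exact hX.bsdp_rankOne_of_chiBranchLower_of_wuthrichHalf_of_branchPAdicGrossZagier hDel hWu hmod hmodD
      hGZK he hp4 hcm hna hr hdiv fun Dh hB ↦ ⟨hSall Dh hB, hGZ Dh hB⟩

/-- **X3♯(G-ord) ∩ `I₀*`, `p ≡ 3 (mod 4)`, `p ≥ 5`, non-CM, non-anomalous, `r_an = 1`: `BSD(E,p)` from the
branch IMC (typed odd LOWER + Wuthrich's half) ∧ Delbourgo 2002 (A)+(B) ∧ [rider ∧ typed odd-branch
`p`-adic GZ for every (B)-datum].** [cite: Wuthrich2014, Thm. 16 (p. 397)]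
[cite: Delbourgo2002, Theorem (A), (B) (p. 40)] [cite: Miller2011LMS, Def. 1.1] -/
theorem ClassX3Gord.bsdp_rankOne_of_chiBranchLowerOdd_of_wuthrichHalf_of_branchPAdicGrossZagierOdd
    (hDel : Delbourgo2002.mainTheorem) (hWu : Wuthrich2014.thm16_halfEigenCharIdeal_dvd_cyclotomicPrime)
    (hmod : hasEntireLFunction_rat) (hmodD : nonempty_modularParametrizationData)
    (hGZK : rank_eq_analyticRank_of_analyticRank_le_one) (hX : ClassX3Gord W p)
    (he : semistabilityIndex W p = 2) (hp4 : p % 4 = 3) (hp5 : 5 ≤ p) (hcm : ¬ W.HasCM)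
    (hna : ReductionNonAnomalous W p) (hr : W.analyticRank = 1)
    (hdiv : ChiBranchLowerDivisibilityOddAt W p)
    (hGZ : ∀ Dh : PAdicHeightData W p, LeadingTermClauses W p Dh →
      SchneiderConjecture Dh ∧ BranchPAdicGrossZagierOddAt W p Dh) : BSDp W p := by
  have hl : MissingLowerBoundAt W p :=
    hX.missingLowerBoundAt_rankOne_of_chiBranchLowerOdd_of_branchPAdicGrossZagierOdd hDel hmod hmodD hGZK
      he hp4 hp5 hcm hna hr hdiv hGZ
  obtain ⟨Dh, hB⟩ := hDel.exists_leadingTermClauses hp5 hcm hX.1.2 hX.2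
  obtain ⟨hS, hGZDh⟩ := hGZ Dh hB
  have hu : MissingUpperBoundAt W p :=
    hX.missingUpperBoundAt_rankOne_of_wuthrichHalf_of_branchPAdicGrossZagierOdd hWu hGZK hmod hmodD he
      hp4 hr hB hS hGZDh
  exact bsdp_of_missingPPartAt W p hGZK (by rw [hr]) (missingPPartAt_of_lower_of_upper W p hl hu)

/-- **THE LOOP CLOSED on X3♯(G-ord), odd branch, `p ≥ 7` (iff).** [cite: Wuthrich2014, Thm. 16 (p. 397)]
[cite: Delbourgo2002, Theorem (A), (B) (p. 40)] [cite: Miller2011LMS, Def. 1.1] -/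
theorem ClassX3Gord.bsdp_iff_forall_branchPAdicGrossZagierOddAt_of_chiBranchLowerOdd_of_wuthrichHalf
    (hDel : Delbourgo2002.mainTheorem) (hWu : Wuthrich2014.thm16_halfEigenCharIdeal_dvd_cyclotomicPrime)
    (hmod : hasEntireLFunction_rat) (hmodD : nonempty_modularParametrizationData)
    (hGZK : rank_eq_analyticRank_of_analyticRank_le_one) (hX : ClassX3Gord W p)
    (he : semistabilityIndex W p = 2) (hp4 : p % 4 = 3) (hp5 : 5 ≤ p) (hcm : ¬ W.HasCM)
    (hna : ReductionNonAnomalous W p) (hr : W.analyticRank = 1)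
    (hdiv : ChiBranchLowerDivisibilityOddAt W p)
    (hSall : ∀ Dh : PAdicHeightData W p, LeadingTermClauses W p Dh → SchneiderConjecture Dh) :
    BSDp W p ↔
      ∀ Dh : PAdicHeightData W p, LeadingTermClauses W p Dh → BranchPAdicGrossZagierOddAt W p Dh := by
  refine ⟨fun hbsd Dh hB ↦ ?_, fun hGZ ↦ ?_⟩
  · exact hX.branchPAdicGrossZagierOddAt_of_bsdp_of_chiBranchLowerOdd_of_wuthrichHalf hWu hmod hr hna hbsd
      hdiv hB (hSall Dh hB)
  · exact hX.bsdp_rankOne_of_chiBranchLowerOdd_of_wuthrichHalf_of_branchPAdicGrossZagierOdd hDel hWu hmod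
      hmodD hGZK he hp4 hp5 hcm hna hr hdiv fun Dh hB ↦ ⟨hSall Dh hB, hGZ Dh hB⟩

end Summit.BirchSwinnertonDyer.Rank1Residual.Additive

/-! ### §3 X3♯(G-ord) at `p = 3`, odd branch (forward form = n1011-p12's; Delbourgo at `3` = p16's) -/

namespace Summit.BirchSwinnertonDyer.Rank1Residual.Additive

variable {W : WeierstrassCurve ℚ} [W.IsElliptic] [W.IsGloballyMinimal] [h3 : Fact (Nat.Prime 3)]

/-- **X3♯(G-ord)@3 (defect `2` automatic), non-CM, non-anomalous, `r_an = 1`: `BSD(E,3)` from the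
branch IMC at `3` (typed odd LOWER + Wuthrich's half) ∧ Delbourgo 2002 at `3` (p16's
`mainTheorem_three`) ∧ [rider ∧ typed odd-branch 3-adic GZ for every (B)-datum].** Lower half =
n1011-p12's `ClassX3Gord.missingLowerBoundAt_three_rankOne_of_chiBranchLowerOdd_of_branchPAdicGrossZagierOdd`;
upper half = `…_of_wuthrichHalf_of_branchPAdicGrossZagierOdd` at `3`. NO image hypothesis.
[cite: Wuthrich2014, Thm. 16 (p. 397)] [cite: Delbourgo2002, Theorem (A), (B), Example (p. 40)]
[cite: Miller2011LMS, Def. 1.1] -/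
theorem ClassX3Gord.bsdp_three_rankOne_of_chiBranchLowerOdd_of_wuthrichHalf_of_branchPAdicGrossZagierOdd
    (hDel3 : Delbourgo2002.mainTheorem_three)
    (hWu : Wuthrich2014.thm16_halfEigenCharIdeal_dvd_cyclotomicPrime)
    (hmod : hasEntireLFunction_rat) (hmodD : nonempty_modularParametrizationData)
    (hGZK : rank_eq_analyticRank_of_analyticRank_le_one) (hX : ClassX3Gord W 3) (hcm : ¬ W.HasCM)
    (hna : ReductionNonAnomalous W 3) (hr : W.analyticRank = 1)
    (hdiv : ChiBranchLowerDivisibilityOddAt W 3)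
    (hGZ : ∀ Dh : PAdicHeightData W 3, LeadingTermClauses W 3 Dh →
      SchneiderConjecture Dh ∧ BranchPAdicGrossZagierOddAt W 3 Dh) : BSDp W 3 := by
  have he : semistabilityIndex W 3 = 2 :=
    semistabilityIndex_eq_two_of_typeG_three W hX.typeGOrd.typeG hX.addv
  have hl : MissingLowerBoundAt W 3 :=
    hX.missingLowerBoundAt_three_rankOne_of_chiBranchLowerOdd_of_branchPAdicGrossZagierOdd hDel3 hmod hmodD
      hGZK hcm hna hr hdiv hGZ
  obtain ⟨-, Dh, hB⟩ := hX.delbourgo2002_three hDel3 hcm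
  obtain ⟨hS, hGZDh⟩ := hGZ Dh hB
  have hu : MissingUpperBoundAt W 3 :=
    hX.missingUpperBoundAt_rankOne_of_wuthrichHalf_of_branchPAdicGrossZagierOdd hWu hGZK hmod hmodD he
      (by norm_num) hr hB hS hGZDh
  exact bsdp_of_missingPPartAt W 3 hGZK (by rw [hr]) (missingPPartAt_of_lower_of_upper W 3 hl hu)

/-- **THE LOOP CLOSED on X3♯(G-ord) at `p = 3`, odd branch (iff).**
[cite: Wuthrich2014, Thm. 16 (p. 397)] [cite: Delbourgo2002, Theorem (A), (B), Example (p. 40)]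
[cite: Miller2011LMS, Def. 1.1] -/
theorem ClassX3Gord.bsdp_three_iff_forall_branchPAdicGrossZagierOddAt_of_chiBranchLowerOdd_of_wuthrichHalf
    (hDel3 : Delbourgo2002.mainTheorem_three)
    (hWu : Wuthrich2014.thm16_halfEigenCharIdeal_dvd_cyclotomicPrime)
    (hmod : hasEntireLFunction_rat) (hmodD : nonempty_modularParametrizationData)
    (hGZK : rank_eq_analyticRank_of_analyticRank_le_one) (hX : ClassX3Gord W 3) (hcm : ¬ W.HasCM)
    (hna : ReductionNonAnomalous W 3) (hr : W.analyticRank = 1)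
    (hdiv : ChiBranchLowerDivisibilityOddAt W 3)
    (hSall : ∀ Dh : PAdicHeightData W 3, LeadingTermClauses W 3 Dh → SchneiderConjecture Dh) :
    BSDp W 3 ↔
      ∀ Dh : PAdicHeightData W 3, LeadingTermClauses W 3 Dh → BranchPAdicGrossZagierOddAt W 3 Dh := by
  refine ⟨fun hbsd Dh hB ↦ ?_, fun hGZ ↦ ?_⟩
  · exact hX.branchPAdicGrossZagierOddAt_of_bsdp_of_chiBranchLowerOdd_of_wuthrichHalf hWu hmod hr hna hbsd
      hdiv hB (hSall Dh hB)
  · exact hX.bsdp_three_rankOne_of_chiBranchLowerOdd_of_wuthrichHalf_of_branchPAdicGrossZagierOdd hDel3 hWu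
      hmod hmodD hGZK hcm hna hr hdiv fun Dh hB ↦ ⟨hSall Dh hB, hGZ Dh hB⟩

end Summit.BirchSwinnertonDyer.Rank1Residual.Additive

end
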